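import Mathlib
import HarnessLib
import Summits.NavierStokesRegularity.NavierStokesRegularity.Theorems.PoloidalWindowDoorPoloidalWindowRigidityUntwistedIsoparametricClass

/-!
# Route `PoloidalWindowDoor`, crux `PoloidalWindowRigidity` (K2, stmt-NavierStokesRegularity-19708), skeleton `lrc-jet` v5,
# stub `stub_untwisted` — brick F5 (part 2, regularity supplement): A LEAFWISE STRUCTURE FUNCTION IS AS SMOOTH AS THE FUNCTION IT
# REPRESENTS, so the isoparametric endgame needs NO regularity hypothesis on the Cramer quotients

Cell ns-regularity-ideate, seat ns-poloidal-K2-p3 (gen 6; `--supports stmt-NavierStokesRegularity-19708`, helper toward `stub_untwisted` of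
`Cruxes/PoloidalWindowRigidity/Lines/lrc_jet.lean` v5 and toward item stmt-20428 `LrcModEntire` (skeleton twist-split, stub `stub_untwistedGerm`);
sequel of `…UntwistedIsoparametric{,Class}`).

The lead's separation files (`…UntwistedSeparation{,2}`, bricks F3a/F3b) produce the leafwise identities `|∇ₕw|² = a(w,y₂)`, `Δₕw = b(w,y₂)`
with `a, b` EXISTENTIALLY quantified Cramer quotients, while `…UntwistedIsoparametricClass.not_isBackwardSingularPoint_of_leafwise` asks for
`a ∈ C²`, `b ∈ C¹` at the base leaf point.  This file removes that bookkeeping from the assembly: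

* `contDiffAt_leafFn_of_comp` — **pure calculus.**  If `g(y) = a(w(y), y₂)` for all `y` near `y₁`, with `w, g` of class `Cⁿ` at `y₁` (`n ≠ 0`,
  `n = ω` allowed) and `∇ₕw(y₁) ≠ 0`, then `a` is of class `Cⁿ` at `(w y₁, (y₁)₂)` — whatever its values off the image of the leaf map: straighten
  `w` to a coordinate by the local `Cⁿ` diffeomorphism `Θ y = y + (w y − y_{b₀})e_{b₀}` (`Cⁿ` inverse function theorem, as in
  `Literature.Analysis.Calculus.exists_comp_of_bracket_eq_zero`) and read `a = g ∘ Θ⁻¹ ∘ ι` near the base point along the affine section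
  `ι(q,z) = Θ y₁ + (q − w y₁)e_{b₀} + (z − (y₁)₂)e₂`.
* `not_isBackwardSingularPoint_of_leafwise'` / `lrcGerm_of_leafwise'` — **BRICK F5 WITHOUT REGULARITY SIDE CONDITIONS:** class profile, slice
  `s < 0`, open `U ∋ y₀` with `∇ₕv₂(s,y₀) ≠ 0`, untwisted structure function `P` (`C¹` at the leaf points of `U`) and ANY functions `a, b` with
  `|∇ₕv₂|² = a(v₂,y₂)`, `Δₕv₂ = b(v₂,y₂)` on `U` ⇒ `¬ IsBackwardSingularPoint v 0`, resp. the `LrcModEntire` germ (the slice is analytic, so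
  `|∇ₕv₂|²`, `Δₕv₂` are `C^∞` in `y`, hence `a ∈ C²`, `b ∈ C¹` at the base leaf point by the first item).

WHAT THIS IS NOT: not a claim about Navier–Stokes regularity and not the stub — interface glue between the lead's F3 output and the K2-p3 endgame
(bears_on LADDER-NS N0 via crux K2 = stmt-19708 and item stmt-20428).
-/

noncomputable section

-- the summit and its single sub-problem share the name (CONVENTIONS §1), as in every Theorems file
set_option linter.dupNamespace false

namespace Summit.NavierStokesRegularity.NavierStokesRegularity.Theorems.PoloidalWindowDoorPoloidalWindowRigidityUntwistedLeafRegularity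

open Set Function Filter Topology Metric
open scoped RealInnerProductSpace InnerProductSpace ContDiff
open Literature.Analysis Literature.Analysis.FluidPDE
open Summit.NavierStokesRegularity.NavierStokesRegularity.Theorems.LocalSineTubeDoorProfileAlignedWindowRigidityAncient
open Summit.NavierStokesRegularity.NavierStokesRegularity.Theorems.PoloidalWindowDoorPoloidalWindowRigidityConstantShearMeans
open Summit.NavierStokesRegularity.NavierStokesRegularity.Theorems.PoloidalWindowDoorPoloidalWindowRigidityUntwistedSeparation
open Summit.NavierStokesRegularity.NavierStokesRegularity.Theorems.PoloidalWindowDoorPoloidalWindowRigidityUntwistedIsoparametricClass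

/-! ### A rank-one perturbation of the identity -/

/-- Sherman–Morrison, rank one: for a continuous linear functional `φ` and a vector `u` with `1 + φ u ≠ 0`, `h ↦ h + φ(h) • u` is a continuous
linear automorphism (the derivative of the straightening map).  (Re-proved here because the copy in
`Literature.Analysis.Calculus.FunctionalDependence` is private.) [folklore] -/
theorem exists_rankOne_equiv {E : Type*} [NormedAddCommGroup E] [NormedSpace ℝ E] (φ : E →L[ℝ] ℝ) (u : E) (h : 1 + φ u ≠ 0) :
    ∃ A : E ≃L[ℝ] E, ∀ x, A x = x + φ x • u := by
  refine ⟨ContinuousLinearEquiv.equivOfInverse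
    (ContinuousLinearMap.id ℝ E + φ.smulRight u)
    (ContinuousLinearMap.id ℝ E - ((1 + φ u)⁻¹ • φ).smulRight u) ?_ ?_, fun x => rfl⟩
  · intro x
    simp only [add_apply, ContinuousLinearMap.id_apply, ContinuousLinearMap.smulRight_apply, sub_apply,
      smul_apply, map_add, map_smul, smul_eq_mul]
    match_scalars <;> field_simp
    ring
  · intro x
    simp only [add_apply, ContinuousLinearMap.id_apply, ContinuousLinearMap.smulRight_apply, sub_apply,
      smul_apply, map_sub, map_smul, smul_eq_mul]
    match_scalars <;> field_simp
    ring

/-! ### A leafwise structure function inherits the regularity of the function it represents -/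

/-- **Regularity of a structure function through a submersive leaf map.**  Let `w g : ℝ³ → ℝ` be of class `Cⁿ` at `y₁` (`n ≠ 0`; `n = ω`
allowed), `∇ₕw(y₁) ≠ 0`, and `a : ℝ × ℝ → ℝ` ANY function with `g(y) = a(w(y), y₂)` for all `y` near `y₁`.  Then `a` is of class `Cⁿ` at the
leaf point `(w y₁, (y₁)₂)`.  (Straighten `w` by the local `Cⁿ` diffeomorphism `Θ y = y + (w y − y_{b₀})e_{b₀}`, `∂_{b₀}w(y₁) ≠ 0`; then
`a(q,z) = g(Θ⁻¹(Θ y₁ + (q − w y₁)e_{b₀} + (z − (y₁)₂)e₂))` for `(q,z)` near the base point.) [folklore] -/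
theorem contDiffAt_leafFn_of_comp {n : WithTop ℕ∞} (hn : n ≠ 0)
    {w g : EuclideanSpace ℝ (Fin 3) → ℝ} {a : ℝ × ℝ → ℝ} {y₁ : EuclideanSpace ℝ (Fin 3)}
    (hw : ContDiffAt ℝ n w y₁) (hg : ContDiffAt ℝ n g y₁)
    (hpin : fderiv ℝ w y₁ (EuclideanSpace.single 0 (1 : ℝ)) ≠ 0 ∨ fderiv ℝ w y₁ (EuclideanSpace.single 1 (1 : ℝ)) ≠ 0)
    (hcomp : ∀ᶠ y in 𝓝 y₁, g y = a (w y, y 2)) :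
    ContDiffAt ℝ n a (w y₁, y₁ 2) := by
  -- the pivot index `b₀ ≠ 2` with `∂_{b₀}w(y₁) ≠ 0`
  obtain ⟨b₀, hb₀, hpin0⟩ : ∃ b₀ : Fin 3, b₀ ≠ 2 ∧ fderiv ℝ w y₁ (EuclideanSpace.single b₀ (1 : ℝ)) ≠ 0 := by
    rcases hpin with h | h
    · exact ⟨0, by decide, h⟩
    · exact ⟨1, by decide, h⟩
  set u : EuclideanSpace ℝ (Fin 3) := EuclideanSpace.single b₀ (1 : ℝ) with hu
  set e₂ : EuclideanSpace ℝ (Fin 3) := EuclideanSpace.single 2 (1 : ℝ) with he₂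
  set ℓ : EuclideanSpace ℝ (Fin 3) →L[ℝ] ℝ := EuclideanSpace.proj b₀ with hℓ
  have hℓu : ℓ u = 1 := by simp [hℓ, hu]
  -- the straightening map and its invertible derivative at `y₁`
  set φ : EuclideanSpace ℝ (Fin 3) →L[ℝ] ℝ := fderiv ℝ w y₁ - ℓ with hφ
  have hφu : 1 + φ u = fderiv ℝ w y₁ u := by
    simp only [hφ, sub_apply, hℓu]; ring
  have h1φ : 1 + φ u ≠ 0 := by rw [hφu]; exact hpin0
  obtain ⟨A, hA⟩ := exists_rankOne_equiv φ u h1φ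
  set Θ : EuclideanSpace ℝ (Fin 3) → EuclideanSpace ℝ (Fin 3) := fun y => y + (w y - ℓ y) • u with hΘ
  have hΘd : HasFDerivAt Θ (A : EuclideanSpace ℝ (Fin 3) →L[ℝ] EuclideanSpace ℝ (Fin 3)) y₁ := by
    have h1 : HasFDerivAt (fun y => w y - ℓ y) φ y₁ := (hw.differentiableAt hn).hasFDerivAt.sub ℓ.hasFDerivAt
    have h2 := (hasFDerivAt_id y₁).add (h1.smul_const u)
    refine h2.congr_fderiv ?_
    ext h
    simp [hA]
  have hΘc : ContDiffAt ℝ n Θ y₁ := contDiffAt_id.add ((hw.sub ℓ.contDiff.contDiffAt).smul contDiffAt_const)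
  have hstrict : HasStrictFDerivAt Θ (A : EuclideanSpace ℝ (Fin 3) →L[ℝ] EuclideanSpace ℝ (Fin 3)) y₁ := hΘc.hasStrictFDerivAt' hΘd hn
  -- the local inverse
  set Ψ : EuclideanSpace ℝ (Fin 3) → EuclideanSpace ℝ (Fin 3) := hΘc.localInverse hΘd hn with hΨ
  have hΘΨ : ∀ᶠ x in 𝓝 (Θ y₁), Θ (Ψ x) = x := hstrict.eventually_right_inverse
  have hΨa : Ψ (Θ y₁) = y₁ := hstrict.localInverse_apply_image
  have hΨt : Tendsto Ψ (𝓝 (Θ y₁)) (𝓝 y₁) := hstrict.localInverse_tendsto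
  have hΨc : ContDiffAt ℝ n Ψ (Θ y₁) := hΘc.to_localInverse hΘd hn
  -- coordinates of `Θ y`: the `b₀`-coordinate is `w y`, the height is unchanged
  have hΘb₀ : ∀ y, Θ y b₀ = w y := fun y => by
    simp [hΘ, hu, hℓ]
  have hΘ2 : ∀ y, Θ y 2 = y 2 := fun y => by
    simp [hΘ, hu, hb₀.symm]
  -- the affine section `ι(q, z) = Θ y₁ + (q − w y₁) u + (z − (y₁)₂) e₂`
  set ι : ℝ × ℝ → EuclideanSpace ℝ (Fin 3) := fun p => Θ y₁ + (p.1 - w y₁) • u + (p.2 - y₁ 2) • e₂ with hι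
  have hιc : ContDiff ℝ n ι := by
    simp only [hι]
    fun_prop
  have hι0 : ι (w y₁, y₁ 2) = Θ y₁ := by simp [hι]
  have hιb₀ : ∀ p : ℝ × ℝ, ι p b₀ = p.1 := fun p => by
    simp [hι, hu, he₂, hb₀, hΘb₀ y₁]
  have hι2 : ∀ p : ℝ × ℝ, ι p 2 = p.2 := fun p => by
    simp [hι, hu, he₂, hb₀.symm, hΘ2 y₁]
  -- near the base point, `a = g ∘ Ψ ∘ ι`
  have hιt : Tendsto ι (𝓝 (w y₁, y₁ 2)) (𝓝 (Θ y₁)) := by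
    rw [← hι0]; exact hιc.continuous.tendsto _
  have hev : ∀ᶠ p in 𝓝 (w y₁, y₁ 2), a p = g (Ψ (ι p)) := by
    have h1 : ∀ᶠ p in 𝓝 (w y₁, y₁ 2), Θ (Ψ (ι p)) = ι p := hιt.eventually hΘΨ
    have h2 : ∀ᶠ p in 𝓝 (w y₁, y₁ 2), g (Ψ (ι p)) = a (w (Ψ (ι p)), (Ψ (ι p)) 2) := (hιt.eventually (hΨt.eventually hcomp))
    filter_upwards [h1, h2] with p h1p h2p
    have hw' : w (Ψ (ι p)) = p.1 := by rw [← hΘb₀ (Ψ (ι p)), h1p, hιb₀]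
    have h2' : (Ψ (ι p)) 2 = p.2 := by rw [← hΘ2 (Ψ (ι p)), h1p, hι2]
    rw [h2p, hw', h2']
  -- conclude
  have hcompC : ContDiffAt ℝ n (fun p => g (Ψ (ι p))) (w y₁, y₁ 2) := by
    have hg' : ContDiffAt ℝ n g (Ψ (ι (w y₁, y₁ 2))) := by rw [hι0, hΨa]; exact hg
    have hΨ' : ContDiffAt ℝ n Ψ (ι (w y₁, y₁ 2)) := by rw [hι0]; exact hΨc
    have h1 : ContDiffAt ℝ n (Ψ ∘ ι) (w y₁, y₁ 2) := hΨ'.comp (w y₁, y₁ 2) hιc.contDiffAt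
    have h2 : ContDiffAt ℝ n (g ∘ (Ψ ∘ ι)) (w y₁, y₁ 2) := ContDiffAt.comp (w y₁, y₁ 2) hg' h1
    exact h2
  exact hcompC.congr_of_eventuallyEq hev

/-! ### Brick F5 without regularity side conditions on the Cramer quotients -/

variable {C : ℝ} {v : ℝ → EuclideanSpace ℝ (Fin 3) → EuclideanSpace ℝ (Fin 3)}

/-- **BRICK F5 (no side conditions) — ISOPARAMETRIC LEAVES OF AN UNTWISTED CLASS PROFILE ⇒ THE APEX IS REGULAR.**  As
`…UntwistedIsoparametricClass.not_isBackwardSingularPoint_of_leafwise`, but for ARBITRARY functions `a, b : ℝ × ℝ → ℝ` representing `|∇ₕv₂(s,·)|²`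
and `Δₕv₂(s,·)` leafwise on the open set `U ∋ y₀` (e.g. the existentially quantified Cramer quotients of `…UntwistedSeparation.leafwise_of_wronskian_ne_zero`
restricted to an open set where the Wronskian is non-zero): their regularity at the base leaf point is automatic (`contDiffAt_leafFn_of_comp`, the
slice being analytic). [folklore] -/
theorem not_isBackwardSingularPoint_of_leafwise' (hrate : HasTypeITimeDecay C v)
    (hcont : ContinuousOn (uncurry v) (Iio (0 : ℝ) ×ˢ univ))
    (hmild : ∀ s t : ℝ, s < t → t < 0 → ∀ x,
      v t x = UnboundedOperators.heatExtension (v s) (t - s) x - oseenDuhamel 1 s v v t x)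
    (hdiv : ∀ t < 0, VectorCalculus.IsDivFree (v t))
    (hpol : ∀ s < 0, ∀ y, ⟪curl (v s) y, EuclideanSpace.single 2 1⟫_ℝ = 0)
    {s : ℝ} (hs : s < 0) {U : Set (EuclideanSpace ℝ (Fin 3))} (hU : IsOpen U) {y₀ : EuclideanSpace ℝ (Fin 3)} (hy₀ : y₀ ∈ U)
    {P a b : ℝ × ℝ → ℝ}
    (hPd : ∀ y ∈ U, ContDiffAt ℝ 1 P (v s y 2, y 2))
    (hP : ∀ y ∈ U, fderiv ℝ (fun x => v s x 2) y (EuclideanSpace.single 2 (1 : ℝ)) = P (v s y 2, y 2))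
    (hE : ∀ y ∈ U, fderiv ℝ (fun x => v s x 2) y (EuclideanSpace.single 0 (1 : ℝ)) ^ 2 +
      fderiv ℝ (fun x => v s x 2) y (EuclideanSpace.single 1 (1 : ℝ)) ^ 2 = a (v s y 2, y 2))
    (hM : ∀ y ∈ U, fderiv ℝ (fun y' => fderiv ℝ (fun x => v s x 2) y' (EuclideanSpace.single 0 (1 : ℝ))) y (EuclideanSpace.single 0 (1 : ℝ)) +
      fderiv ℝ (fun y' => fderiv ℝ (fun x => v s x 2) y' (EuclideanSpace.single 1 (1 : ℝ))) y (EuclideanSpace.single 1 (1 : ℝ)) =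
        b (v s y 2, y 2))
    (hnd : fderiv ℝ (fun x => v s x 2) y₀ (EuclideanSpace.single 0 (1 : ℝ)) ≠ 0 ∨
      fderiv ℝ (fun x => v s x 2) y₀ (EuclideanSpace.single 1 (1 : ℝ)) ≠ 0) :
    ¬ IsBackwardSingularPoint v 0 := by
  have hA : AnalyticOnNhd ℝ (v s) univ := analyticOnNhd_slice hcont (bdd_of_hasTypeITimeDecay hrate) hmild hs
  have hw : ContDiff ℝ ∞ (fun x => v s x 2) := contDiff_coord hA.contDiff 2
  -- `E` and `M` are `C^∞` functions of `y`
  have hpart : ∀ c : EuclideanSpace ℝ (Fin 3), ContDiff ℝ ∞ (fun y => fderiv ℝ (fun x => v s x 2) y c) := fun c =>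
    (hw.fderiv_right (m := ∞) (by norm_cast)).clm_apply contDiff_const
  have hpart2 : ∀ c d : EuclideanSpace ℝ (Fin 3), ContDiff ℝ ∞ (fun y => fderiv ℝ (fun y' => fderiv ℝ (fun x => v s x 2) y' c) y d) :=
    fun c d => ((hpart c).fderiv_right (m := ∞) (by norm_cast)).clm_apply contDiff_const
  have hEc : ContDiff ℝ ∞ (fun y => fderiv ℝ (fun x => v s x 2) y (EuclideanSpace.single 0 (1 : ℝ)) ^ 2 +
      fderiv ℝ (fun x => v s x 2) y (EuclideanSpace.single 1 (1 : ℝ)) ^ 2) := ((hpart _).pow 2).add ((hpart _).pow 2)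
  have hMc : ContDiff ℝ ∞ (fun y => fderiv ℝ (fun y' => fderiv ℝ (fun x => v s x 2) y' (EuclideanSpace.single 0 (1 : ℝ))) y (EuclideanSpace.single 0 (1 : ℝ)) +
      fderiv ℝ (fun y' => fderiv ℝ (fun x => v s x 2) y' (EuclideanSpace.single 1 (1 : ℝ))) y (EuclideanSpace.single 1 (1 : ℝ))) :=
    (hpart2 _ _).add (hpart2 _ _)
  have hUy : ∀ᶠ y in 𝓝 y₀, y ∈ U := hU.mem_nhds hy₀
  have ha : ContDiffAt ℝ 2 a (v s y₀ 2, y₀ 2) :=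
    contDiffAt_leafFn_of_comp (n := 2) (by norm_num) (hw.of_le (by norm_cast)).contDiffAt (hEc.of_le (by norm_cast)).contDiffAt hnd
      (hUy.mono fun y hy => hE y hy)
  have hb : ContDiffAt ℝ 1 b (v s y₀ 2, y₀ 2) :=
    contDiffAt_leafFn_of_comp (n := 1) (by norm_num) (hw.of_le (by norm_cast)).contDiffAt (hMc.of_le (by norm_cast)).contDiffAt hnd
      (hUy.mono fun y hy => hM y hy)
  exact not_isBackwardSingularPoint_of_leafwise hrate hcont hmild hdiv hpol hs hU hy₀ hPd hP ha hb hE hM hnd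

/-- **Brick F5 (no side conditions) in the currency of item `LrcModEntire` (stmt-20428).**  Same hypotheses as
`not_isBackwardSingularPoint_of_leafwise'`; conclusion VERBATIM the item's germ trichotomy. [folklore] -/
theorem lrcGerm_of_leafwise' (hrate : HasTypeITimeDecay C v)
    (hcont : ContinuousOn (uncurry v) (Iio (0 : ℝ) ×ˢ univ))
    (hmild : ∀ s t : ℝ, s < t → t < 0 → ∀ x,
      v t x = UnboundedOperators.heatExtension (v s) (t - s) x - oseenDuhamel 1 s v v t x)
    (hdiv : ∀ t < 0, VectorCalculus.IsDivFree (v t))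
    (hpol : ∀ s < 0, ∀ y, ⟪curl (v s) y, EuclideanSpace.single 2 1⟫_ℝ = 0)
    {s : ℝ} (hs : s < 0) {U : Set (EuclideanSpace ℝ (Fin 3))} (hU : IsOpen U) {y₀ : EuclideanSpace ℝ (Fin 3)} (hy₀ : y₀ ∈ U)
    {P a b : ℝ × ℝ → ℝ}
    (hPd : ∀ y ∈ U, ContDiffAt ℝ 1 P (v s y 2, y 2))
    (hP : ∀ y ∈ U, fderiv ℝ (fun x => v s x 2) y (EuclideanSpace.single 2 (1 : ℝ)) = P (v s y 2, y 2))
    (hE : ∀ y ∈ U, fderiv ℝ (fun x => v s x 2) y (EuclideanSpace.single 0 (1 : ℝ)) ^ 2 +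
      fderiv ℝ (fun x => v s x 2) y (EuclideanSpace.single 1 (1 : ℝ)) ^ 2 = a (v s y 2, y 2))
    (hM : ∀ y ∈ U, fderiv ℝ (fun y' => fderiv ℝ (fun x => v s x 2) y' (EuclideanSpace.single 0 (1 : ℝ))) y (EuclideanSpace.single 0 (1 : ℝ)) +
      fderiv ℝ (fun y' => fderiv ℝ (fun x => v s x 2) y' (EuclideanSpace.single 1 (1 : ℝ))) y (EuclideanSpace.single 1 (1 : ℝ)) =
        b (v s y 2, y 2))
    (hnd : fderiv ℝ (fun x => v s x 2) y₀ (EuclideanSpace.single 0 (1 : ℝ)) ≠ 0 ∨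
      fderiv ℝ (fun x => v s x 2) y₀ (EuclideanSpace.single 1 (1 : ℝ)) ≠ 0) :
    ∃ s' : ℝ, s' < 0 ∧ ∃ U' : Set (EuclideanSpace ℝ (Fin 3)), IsOpen U' ∧ U'.Nonempty ∧
      ((∃ e : EuclideanSpace ℝ (Fin 3), e ≠ 0 ∧ ∀ y ∈ U', fderiv ℝ (curl (v s')) y e = 0) ∨
       (∃ c : EuclideanSpace ℝ (Fin 3), ∀ y ∈ U',
          rotGen (curl (v s') y) = fderiv ℝ (curl (v s')) y (rotGen (y - c))) ∨
       (∃ w : EuclideanSpace ℝ (Fin 3) → EuclideanSpace ℝ (Fin 3), AnalyticOnNhd ℝ w univ ∧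
          ¬ BddAbove (Set.range fun y => ‖w y‖) ∧ ∀ y ∈ U', v s' y = w y)) := by
  have hA : AnalyticOnNhd ℝ (v s) univ := analyticOnNhd_slice hcont (bdd_of_hasTypeITimeDecay hrate) hmild hs
  have hw : ContDiff ℝ ∞ (fun x => v s x 2) := contDiff_coord hA.contDiff 2
  have hpart : ∀ c : EuclideanSpace ℝ (Fin 3), ContDiff ℝ ∞ (fun y => fderiv ℝ (fun x => v s x 2) y c) := fun c =>
    (hw.fderiv_right (m := ∞) (by norm_cast)).clm_apply contDiff_const
  have hpart2 : ∀ c d : EuclideanSpace ℝ (Fin 3), ContDiff ℝ ∞ (fun y => fderiv ℝ (fun y' => fderiv ℝ (fun x => v s x 2) y' c) y d) :=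
    fun c d => ((hpart c).fderiv_right (m := ∞) (by norm_cast)).clm_apply contDiff_const
  have hEc : ContDiff ℝ ∞ (fun y => fderiv ℝ (fun x => v s x 2) y (EuclideanSpace.single 0 (1 : ℝ)) ^ 2 +
      fderiv ℝ (fun x => v s x 2) y (EuclideanSpace.single 1 (1 : ℝ)) ^ 2) := ((hpart _).pow 2).add ((hpart _).pow 2)
  have hMc : ContDiff ℝ ∞ (fun y => fderiv ℝ (fun y' => fderiv ℝ (fun x => v s x 2) y' (EuclideanSpace.single 0 (1 : ℝ))) y (EuclideanSpace.single 0 (1 : ℝ)) +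
      fderiv ℝ (fun y' => fderiv ℝ (fun x => v s x 2) y' (EuclideanSpace.single 1 (1 : ℝ))) y (EuclideanSpace.single 1 (1 : ℝ))) :=
    (hpart2 _ _).add (hpart2 _ _)
  have hUy : ∀ᶠ y in 𝓝 y₀, y ∈ U := hU.mem_nhds hy₀
  have ha : ContDiffAt ℝ 2 a (v s y₀ 2, y₀ 2) :=
    contDiffAt_leafFn_of_comp (n := 2) (by norm_num) (hw.of_le (by norm_cast)).contDiffAt (hEc.of_le (by norm_cast)).contDiffAt hnd
      (hUy.mono fun y hy => hE y hy)
  have hb : ContDiffAt ℝ 1 b (v s y₀ 2, y₀ 2) :=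
    contDiffAt_leafFn_of_comp (n := 1) (by norm_num) (hw.of_le (by norm_cast)).contDiffAt (hMc.of_le (by norm_cast)).contDiffAt hnd
      (hUy.mono fun y hy => hM y hy)
  exact lrcGerm_of_leafwise hrate hcont hmild hdiv hpol hs hU hy₀ hPd hP ha hb hE hM hnd

end Summit.NavierStokesRegularity.NavierStokesRegularity.Theorems.PoloidalWindowDoorPoloidalWindowRigidityUntwistedLeafRegularity

end
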